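import Summits.BirchSwinnertonDyer.BirchSwinnertonDyer.Theorems.EisensteinDepletionAtTwoStarOptBSFSigmaNode
import Summits.BirchSwinnertonDyer.BirchSwinnertonDyer.Theorems.EisensteinDepletionAtTwoStarPrimeLevel
import HarnessLib

/-!
# Line `star` on crux E1M (stmt-BirchSwinnertonDyer-20341): the node law (N256) AT PRIME LEVEL — every formal rational 2-torsion abscissa of a curve of
# prime conductor `≠ 17` has complementary discriminant `−256` (modulo Setzer's classification)

Lead star-p1 GEN 17.  The research stub `stub_sigmaNode` of Lines/star.lean v10 (N256: a formal Σ-type rational 2-torsion abscissa `r` of the lattice-optimal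
`W₀` has `(b₂ + 12r)² − 32(b₄ + r b₂ + 6r²) = ±256`) is DISCHARGED on the infinite family of PRIME levels `≠ 17`, where it holds for EVERY curve with a formal
rational 2-torsion abscissa (no optimality needed), with the sign `−`: by Setzer's classification (tree named fact `Setzer1975_primeConductor_rationalTwoTorsion`)
such a curve is `ℚ`-isomorphic to a Neumann–Setzer model `E₀(u)` or `E₁(u)`; on `E₁(u)` the rational abscissa is integral (not formal); on `E₀(u)` it is `u/4` with
`b₂ = −u`, `b₄ = 8`, so `α = 2u`, `β = 8 + u²/8` and `α² − 32β = −256`; and `α² − 32β` is an invariant of weight 4 of the pair (curve, abscissa) under changes of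
variables (`complDisc_smul`), hence unchanged between two globally minimal models (`u = ±1`).  (At `N = 17` the statement needs optimality: the non-optimal `17a3`
has a formal abscissa `−21/4` with complementary discriminant `17·256`; the lattice-optimal `17a1` gives `−256`.  The −256 branch of the GEN 17 census is exactly the
90 prime levels `17`, `u² + 64 < 5·10⁵`.)

* `complDisc_smul` — `(α² − 32β)(C • W, u⁻²(x − r)) = u⁻⁴ · (α² − 32β)(W, x)` (weight 4);
* `complDisc_neumannSetzerCurve₀` — on `E₀(u)` at `x = u/4` the complementary discriminant is `−256`;
* `complDisc_eq_neg_of_prime_conductor` — prime conductor `≠ 17`, formal rational abscissa ⇒ `α² − 32β = −256` (mod Setzer);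
* `sigmaNode_of_prime_conductor` — the registered stub's statement with the extra hypotheses «`N_{W₀}` prime, `≠ 17`» (mod Setzer; the lattice / parity
  hypotheses are not used).

CONDITIONAL on the print `Setzer1975_primeConductor_rationalTwoTorsion` (hypothesis); no `sorry`, no new definition; nothing here reads `r_an`; E1M / BSD NOT proved.
-/

set_option linter.dupNamespace false
set_option autoImplicit false

noncomputable section

open scoped Classical MatrixGroups
open CongruenceSubgroup
open WeierstrassCurve Literature.NumberTheory.EllipticCurves Literature.NumberTheory.EllipticCurves.Greenberg1999
open Literature.NumberTheory.EllipticCurves.ModularForms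

namespace Summit.BirchSwinnertonDyer.BirchSwinnertonDyer.Theorems.DepletionAtTwo.SigmaNode

/-! ### The complementary discriminant is a weight-4 invariant -/

/-- **Weight-4 invariance of the complementary discriminant** under `x = u²x' + r`: with `α = b₂ + 12x`, `β = b₄ + x b₂ + 6x²` one has `α' = u⁻²α`,
`β' = u⁻⁴β`, so `α'² − 32β' = u⁻⁴(α² − 32β)`. [cite: SilvermanAEC2009, III.1 Table 3.1 (b₂', b₄')] -/
theorem complDisc_smul (W : WeierstrassCurve ℚ) (C : VariableChange ℚ) (x : ℚ) :
    ((C • W).b₂ + 12 * C.toX x) ^ 2 - 32 * ((C • W).b₄ + C.toX x * (C • W).b₂ + 6 * C.toX x ^ 2) =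
      ((C.u : ℚ)⁻¹) ^ 4 * ((W.b₂ + 12 * x) ^ 2 - 32 * (W.b₄ + x * W.b₂ + 6 * x ^ 2)) := by
  rw [variableChange_b₂, variableChange_b₄, VariableChange.toX_def]
  simp only [Units.val_inv_eq_inv_val]
  ring

/-- **On the Neumann–Setzer model `E₀(u)` the complementary discriminant at `x = u/4` is `−256`** (`b₂ = −u`, `b₄ = 8`: `α = 2u`, `β = 8 + u²/8`).
[cite: SteinWatkins2004, §1 eq. (1) (PDF p. 3)] -/
theorem complDisc_neumannSetzerCurve₀ (u : ℤ) :
    ((neumannSetzerCurve₀ u).b₂ + 12 * ((u : ℚ) / 4)) ^ 2 -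
      32 * ((neumannSetzerCurve₀ u).b₄ + (u : ℚ) / 4 * (neumannSetzerCurve₀ u).b₂ + 6 * ((u : ℚ) / 4) ^ 2) = -256 := by
  simp only [neumannSetzerCurve₀, WeierstrassCurve.b₂, WeierstrassCurve.b₄]
  ring

/-! ### Prime conductor `≠ 17` -/

/-- **The node law at prime conductor `≠ 17` (mod Setzer), for EVERY curve**: a globally minimal `W` of prime conductor `≠ 17` and a rational 2-torsion
abscissa `x` ramified at 2 have complementary discriminant `−256`.  Setzer: `C • W = E₀(u)` or `E₁(u)`; the `E₁(u)` case is impossible (the transported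
abscissa is `0`, so `x = r ∈ ℤ` is not ramified); in the `E₀(u)` case the transported abscissa is `u/4`, `complDisc_neumannSetzerCurve₀` and `complDisc_smul`
with `u_C² = 1`. CONDITIONAL on `Setzer1975_primeConductor_rationalTwoTorsion`. [cite: Setzer1975, pp. 367–378 (main theorem)] [cite: Mazur1977, III §7 (p. 162)] -/
theorem complDisc_eq_neg_of_prime_conductor (hS : Setzer1975_primeConductor_rationalTwoTorsion)
    (W : WeierstrassCurve ℚ) [W.IsElliptic] [W.IsGloballyMinimal] (hN : (W.conductorNorm ℤ).Prime) (h17 : W.conductorNorm ℤ ≠ 17)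
    {x : ℚ} (hx : HasRationalTwoTorsionX W x) (hram : TwoTorsionRamifiedAtTwo x) :
    (W.b₂ + 12 * x) ^ 2 - 32 * (W.b₄ + x * W.b₂ + 6 * x ^ 2) = -256 := by
  rcases hS W x hx hN with h | ⟨u, hu4, hNu, C, hC⟩
  · exact absurd h h17
  rcases hC with hC | hC
  · -- `E₀(u)`
    haveI : (C • W).IsGloballyMinimal := by
      rw [hC]; exact isGloballyMinimal_neumannSetzerCurve₀ u hN hNu hu4
    obtain ⟨hu2, r, hr⟩ := sq_u_eq_one_and_r_int W C
    have hx' : HasRationalTwoTorsionX (neumannSetzerCurve₀ u) (C.toX x) := hC ▸ hasRationalTwoTorsionX_smul W C hx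
    have h4 : C.toX x = (u : ℚ) / 4 := eq_of_hasRationalTwoTorsionX_neumannSetzerCurve₀ u hx'
    have hinv := complDisc_smul W C x
    rw [hC, h4, complDisc_neumannSetzerCurve₀] at hinv
    have hu4' : ((C.u : ℚ)⁻¹) ^ 4 = 1 := by
      have h1 : ((C.u : ℚ)⁻¹) ^ 2 = 1 := by rw [inv_pow, hu2, inv_one]
      nlinarith [h1]
    rw [hu4', one_mul] at hinv
    exact hinv.symm
  · -- `E₁(u)`: the abscissa is integral, not ramified
    exfalso
    haveI : (C • W).IsGloballyMinimal := by
      rw [hC]; exact isGloballyMinimal_neumannSetzerCurve₁ u hN hNu hu4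
    obtain ⟨hu2, r, hr⟩ := sq_u_eq_one_and_r_int W C
    have hx' : HasRationalTwoTorsionX (neumannSetzerCurve₁ u) (C.toX x) := hC ▸ hasRationalTwoTorsionX_smul W C hx
    have h0 : C.toX x = 0 := eq_zero_of_hasRationalTwoTorsionX_neumannSetzerCurve₁ u hN hNu hx'
    have hxr : x = r := by rw [eq_ofX_toX C x, h0, mul_zero, zero_add, hr]
    rw [twoTorsionRamifiedAtTwo_iff, hxr, padicValRat.of_int] at hram
    exact absurd hram (not_lt.mpr (Int.natCast_nonneg _))

/-- **The registered stub `stub_sigmaNode` (Lines/star.lean v10) AT PRIME LEVEL `≠ 17`, modulo Setzer**: its statement with the two extra hypotheses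
«`W₀.conductorNorm ℤ` prime» and «`≠ 17`» (the lattice-optimality and Kummer-parity binders are not used: at prime level the node law holds for every curve).
CONDITIONAL on `Setzer1975_primeConductor_rationalTwoTorsion`. [cite: Setzer1975, pp. 367–378 (main theorem)] [cite: ConradEdixhovenStein2003, Thm. 1.1.1] -/
theorem sigmaNode_of_prime_conductor (hS : Setzer1975_primeConductor_rationalTwoTorsion) :
    ∀ (W₀ : WeierstrassCurve ℚ) [W₀.IsElliptic] [W₀.IsGloballyMinimal], (W₀.conductorNorm ℤ).Prime → W₀.conductorNorm ℤ ≠ 17 →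
      ∀ ⦃N : ℕ⦄ [NeZero N] (f : CuspForm (Gamma0 N) 2), IsNewformOf W₀ f → IsOrdinaryAt W₀ 2 →
      ∀ (L₀ : PeriodPair), IsNeronLatticeOf (W₀.baseChange ℂ) L₀ → ∀ (q : ℚ), q ≠ 0 →
      (∀ z ∈ periodLattice f, (q : ℂ) * z ∈ L₀.lattice) → (∀ z ∈ L₀.lattice, ∃ w ∈ periodLattice f, z = (q : ℂ) * w) →
      ∀ (x : ℚ), HasRationalTwoTorsionX W₀ x → TwoTorsionRamifiedAtTwo x →
      ∀ (lam : ℂ), lam ∈ L₀.lattice → lam / 2 ∉ L₀.lattice →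
        L₀.weierstrassP (lam / 2) - ((W₀.b₂ : ℚ) : ℂ) / 12 = ((x : ℚ) : ℂ) →
      (∀ (γ : SL(2, ℤ)) (hγ : γ ∈ Gamma0 N), γ ∈ Gamma1 N →
        ∃ k : ℤ, ∃ w ∈ L₀.lattice, (q : ℂ) * cuspSymbol f ⟨γ, hγ⟩ = (k : ℂ) * lam + 2 * w) →
      (W₀.b₂ + 12 * x) ^ 2 - 32 * (W₀.b₄ + x * W₀.b₂ + 6 * x ^ 2) = 256 ∨
        (W₀.b₂ + 12 * x) ^ 2 - 32 * (W₀.b₄ + x * W₀.b₂ + 6 * x ^ 2) = -256 := by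
  intro W₀ _ _ hN h17 N _ f _ _ L₀ _ q _ _ _ x hx hram _ _ _ _ _
  exact Or.inr (complDisc_eq_neg_of_prime_conductor hS W₀ hN h17 hx hram)

end Summit.BirchSwinnertonDyer.BirchSwinnertonDyer.Theorems.DepletionAtTwo.SigmaNode

end
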